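import Mathlib
import HarnessLib
import HarnessLib.Audit
import Summits.AtomisticToContinuum.Statement
import Literature.MathematicalPhysics.StatisticalMechanics.BarlowStacking
import Literature.MathematicalPhysics.StatisticalMechanics.HaggStacking
import Literature.MathematicalPhysics.StatisticalMechanics.LennardJonesClusters
import Summits.AtomisticToContinuum.Crystallization.Theorems.ChargedEnergyGap.Negative.Unconditional
import Summits.AtomisticToContinuum.Crystallization.Theorems.ReggeStarCoercivityDefectFreeCrystallizesHullCriterion
import Summits.AtomisticToContinuum.Crystallization.Theorems.PhononSlackCertificatesPeriodicGivenLayered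
import HarnessLib.Audit.Status.Attr

/-!
Route: FluxTubeKepler

DORMANT since 2026-08-26T13:40:19Z (reconciler: no traction for 6.7 d (last activity item-evidence-added at 2026-08-19T20:44:19Z); parked, not closed — `ledger route dormant route-AtomisticToContinuum-FluxTubeKepler --off` to reactivate) — unstaffed, not closed; items shared with open routes are served there. `ledger route dormant <id> --off` reactivates.

# Route FluxTubeKepler — dispersion is 8-D electrostatics — Thomson flux tubes make the LJ tail an
exact cell functional, and a flux-cell Kepler inequality decides both conjuncts

It suffices to show X = FluxCellKepler ∧ PeriodicGivenLayered (card flux-tube-thomson-8d, mechcritic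
grade new-mechanism, realised as a
thin route). FluxCellKepler (NEW, the card's K1 with the flux-tube THEOREM folded in as the
domination clause): there are a periodic
configuration P₀ of ℝ³, a radius R₁ and a LOCAL TAIL CREDIT τ (a real function of the pattern of
relative positions within R₁ of a site)
such that (DOM) for every finite configuration Σ_i Σ_(j≠i) r_ij⁻⁶ ≤ Σ_i τ(pattern_i) — the intended
τ is 2π⁴ times the confined-minus-free
8-D field energy of a unit charge whose flux is confined to the tube (Voronoi cell of i) × ℝ⁵ with a
local antisymmetric facet-flux rule,
for which DOM is Thomson's principle (support FluxTubeBound types the q = 0 case) — and (KEPLER) the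
finite-range cell functional
λ_i = (1/24)Σ_j r_ij⁻¹² − τ(pattern_i)/12 satisfies Σ_i λ_i ≥ N·e(P₀) + c(R,η)·#(sites whose
R-neighbourhood is not η-close to a member
of the relaxed Barlow/layered family) on every δ-separated configuration. PeriodicGivenLayered
(SHARED crux stmt-11779 of HullMinimality):
layered windows at every scale force periodic windows. Conjunct (i) drops out of KEPLER with the
sharp constant (e(P₀) = e*, attained);
conjunct (ii) from the defect budget O(N^(2/3)) ⇒ layered windows ⇒ periodic windows ⇒ the proved
hull criterion.
Lean: `FluxCellKepler ∧ PeriodicGivenLayered`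

## Assembly
Deciding theorem (glue.lean; sorry-free in Sketch.lean / RenderTest.lean against the gate-style
render, axioms standard):
`theorem closes : FluxCellKepler → PeriodicGivenLayered → KeplerEnergyFloor → FloorGivesLayered →
HullCriterion → _root_.Crystallization`.
KeplerEnergyFloor (fed FluxCellKepler and the PROVED LennardJonesMinimalDistance_holds) yields P₀
with N·e(P₀) ≤ E(x) on ground states and
the defect budget; FloorGivesLayered turns these into the layered-window hypothesis of
PeriodicGivenLayered for every ground-state sequence;
PeriodicGivenLayered gives PeriodicWindows; HullCriterion (proved, 3243) gives IsCrystallizing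
lennardJones 3. Conjunct (i) inside the glue:
ground states exist (LennardJonesGroundStatesExist_holds), so e(P₀) ≤ E(N)/N for N ≥ 1;
crysEnergyLimit (proved, 0626) gives E(N)/N → ⨅e,
hence e(P₀) ≤ ⨅e ≤ e(Q) for every periodic Q (eStar_le): IsLeast at P₀, ⨅e = e(P₀), Tendsto —
HasPeriodicGroundStateEnergy lennardJones 3.
The pair is `_root_.Crystallization`. FluxTubeBound, StabilityMilestone and PeriodicWindows are not
antecedents (construction, milestone, the shared hinge kept as an explicit want).

Rationale: WHY THIS LINE. Dictionary (potential theory ↦ dispersion): |x|⁻⁶ on ℝ³ is the Newton kernel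
|y|^(2−8) of ℝ⁸ restricted to a 3-plane (Φ₈ = |y|⁻⁶/(2π⁴),
|S⁷| = π⁴/3), so the London tail of X ⊂ ℝ³ is the 8-D Coulomb energy of unit charges on ℝ³ ⊂ ℝ⁸;
Newton's shell theorem makes ball smearing
EXACT, and Thomson's principle (Coulomb energy = min field energy at prescribed divergence;
ancestors Onsager1939, LiebNarnhofer1975 in the
physical dimension, inequality only) with each charge's flux CONFINED to the tube over its own cell
gives Σ_(i≠j) r_ij⁻⁶ ≤ Σ_i T(Ω_i, x_i; q)
for EVERY antisymmetric facet flux q, with equality iff q is the true wall flux: an exact,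
sign-correct, cutoff-free localisation of the
one irreducibly non-local piece of E_LJ, exact at fcc and sc (all Voronoi facets are mirrors),
strict at hcp by only σ_h ≈ 2.7e-6 (two
orders inside the stacking scale ΔS₆ = 9.8e-4), charging the icosahedral (dodecahedral) cell a mere
+2.4 % — numbers from the card's
Neumann–Yukawa MFS runs (T(rhombic dodecahedron) = S₆(fcc) to 7.6e-7, T(cube) = S₆(sc) to 1.5e-5).
The Bogomolny-type split
E_LJ = Σ_i λ_i^q + 𝔖^q/12 with 𝔖^q = ‖E_q − E_true‖² ≥ 0 turns the crystal problem into a Hales-type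
inequality for a FINITE-RANGE
cell functional with derived, unconstrained, quadratically-priced transfer (HalesDSP2012 §6.3.2 is
the template and names the
failure mode of raw single cells; Hales2012 / FlatleyTheil2015 for the shell geometry downstream).
What no open route does: ThreeCone
prices the tail by Bochner (a structure-blind constant −N f(0)/2), PhononSlack / ReggeStar /
PricedLinkCensus truncate it with error
terms, FreeSplitting splits infinite-range bonds pairwise and must certify every split, PRVariance
is a dimensionless Cauchy–Schwarz
ratio; here the whole tail is a structure-SENSITIVE cell functional with an equality theory
(mirror-complete ⇒ exact ⇒ periodic) and
nothing to certify on the transfer side. The energetic conjunct costs nothing extra: KEPLER with the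
sharp constant makes e(P₀) the
least periodic energy (free-lunch periodisation, in tree: crysEnergyLimit, eStar_le), so
CrysPeriodicMinAttained (0627) is not an item.

RANKED CRUXES. #2 FluxCellKepler (crux) — FLUX-CELL KEPLER INEQUALITY (card K1, domination folded
in). There are P₀ : PeriodicConfiguration 3, R₁ and τ : Finset ℝ³ → ℝ with (DOM) Σ_i siteEnergy(r⁻⁶)
≤ Σ_i τ({x_j − x_i : |x_j − x_i| ≤ R₁}) for every finite injective configuration, and (KEPLER) for
every δ > 0 and every R, η > 0 some c > 0 such that for every δ-separated finite configuration c·#{i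
: no a ∈ [47/50,1], linear isometry A, Hägg word s, layer heights z with increments in [39a/50,
17a/20] make the R-neighbourhood of x_i two-way η-matched with the layered set
A{i·u(a)+j·v(a)+L_s(m)·w(a)+z(m)e₃}} ≤ Σ_i ((1/24)·siteEnergy(r⁻¹²)_i − (1/12)·τ(pattern_i)) −
N·e(P₀). Intended τ = 2π⁴(T(Vor_i, x_i; q) − T(ℝ³)) with a local antisymmetric facet-flux rule q
exact on the Barlow bond types (card), for which DOM is Thomson's principle in ℝ⁸ (FluxTubeBound)
and every q is admissible. [difficulty: open-problem] (why it might fail: Hales-sized: raw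
one-centre value 5.9 % below e* (dodecahedral cell +2.4 % in T) ⇒ first-shell transfer unavoidable;
sharp constant needs τ exact to <7e-5 on fcc/polytype sites and O(strain²) below the phonon penalty
on relaxed layers; a bcc/A15 cell over-credited by >2 % kills q = 0.) [HalesDSP2012, Hales2012,
FlatleyTheil2015, BlancLewin2015, Onsager1939, LiebNarnhofer1975, HalesMcLaughlin2010, Yuhjtman2015,
Literature.Barriers.AtomisticToContinuum.TetrahedralFrustration,
Literature.Barriers.AtomisticToContinuum.ShortRangeStackingBlindness]
#3 PeriodicGivenLayered (crux) — PERIODIC GIVEN LAYERED (SHARED verbatim with HullMinimality,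
stmt-11779): for every sequence of LJ ground states, layered windows at every scale (one in-layer
spacing a ∈ [47/50,1], free Hägg word, free interlayer spacings in the box) imply periodic windows
at every scale for one periodic P (any polytype allowed; expected relaxed hcp). Intended mechanism
as there: Hägg domination + dislocation-loop surgery inside the hull; here it is fed by
FluxCellKepler's defect budget instead of LayeredWindows. [difficulty: L] (why it might fail: Fails
if Hägg domination |J₂| > Σ(k−1)|J_k| breaks on the relaxed (a, spacing) box (ratio 287–587,
uncertified numerics; an exceptional coupling gives Sturmian words = Hubbard risk), or if faults are
syndetic in every layered limit.) [LoachAckland2017, PartayOrtnerCsanyi2017, Stillinger2001,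
Radin1991, Literature.Barriers.AtomisticToContinuum.ShortRangeStackingBlindness,
Literature.Barriers.AtomisticToContinuum.Hubbard1978_mostHomogeneous]
#9 KeplerEnergyFloor (support) — From FluxCellKepler and the proved minimal distance of LJ ground
states: there is P₀ with N·e(P₀) ≤ E(x) for every LJ ground state x (energy identity 2E = Σ site
energies, DOM, KEPLER with D ≥ 0), and for all R, η > 0 some c > 0 with c·#(non-layered sites of x)
≤ E(x) − N·e(P₀) along ground states. Routine bookkeeping (M). [difficulty: M] [BlancLewin2015,
Yuhjtman2015]
#9 FloorGivesLayered (support) — From the floor and the defect budget to the hypothesis of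
PeriodicGivenLayered, per ground-state sequence: E(N) − N·e(P₀) = o(N) (crysEnergyLimit + eStar_le,
in tree) ⇒ the number of non-layered sites is o(N) ⇒ for N large some site is (R, η)-layered-good
with a spacing a_N ∈ [47/50,1]; compactness of [47/50,1] and Lipschitz dependence of the layered set
on a inside B(0,R) fix ONE a for all scales (ε doubled, R decreased by 1). Bookkeeping (M).
[difficulty: M] [BlancLewin2015, PartayOrtnerCsanyi2017]
#9 PeriodicWindows (support) — PERIODIC WINDOWS (SHARED stmt-3240, verbatim; derived here, not
assumed): for every sequence of LJ ground states one periodic P is two-way ε-matched on B(0,R) by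
some translate, frequently in N, for every R, ε. In this route it is the output of
PeriodicGivenLayered ∘ FloorGivesLayered ∘ KeplerEnergyFloor and the input of HullCriterion.
[difficulty: open-problem] [BlancLewin2015, Radin1991]
#9 HullCriterion (support) — HULL CRITERION (the proved shared item stmt-3243 with PeriodicWindows
inlined, so that the decl is self-contained in this file; closed by `exact` of the tree proof):
PeriodicWindows ⇒ IsCrystallizing lennardJones 3 (extraction along (R, ε) = (j+1, 1/(j+1)), minimal
distance, local convergence with multiplicity 1). [difficulty: provable-now] [BlancLewin2015]
#9 FluxTubeBound (support) — THE FLUX-TUBE BOUND (card P1 at zero wall flux; Thomson's principle in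
ℝ⁸, TYPED): for every smearing radius a > 0, every finite configuration x in ℝ³ and every family of
pairwise disjoint cells Ω_i ⊇ closedBall(x_i, a): Σ_i Σ_(j≠i) |x_i − x_j|⁻⁶ ≤ 2π⁴ Σ_i (T_a(Ω_i, x_i)
− T_a(ℝ³, x_i)), where T_a(Ω, x₀) is the infimum of ∫|F|² over L² vector fields F on ℝ⁸ = ℝ³ × ℝ⁵
vanishing off the tube Ω × ℝ⁵ whose weak divergence (against all C¹ compactly supported φ) is the
uniform probability on the 8-ball of radius a about (x₀, 0). Proof: Newton's theorem (disjoint balls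
interact as points, |y|⁻⁶ harmonic in ℝ⁸), completing the square against the true field (density of
C¹_c in Ḣ¹(ℝ⁸)), disjoint tube supports; admissible confined fields exist because the transverse
dimension 5 ≥ 3. Equality iff the true field has zero flux through every wall (mirror-complete
cells: fcc, sc). The general antisymmetric-flux version and the heat-kernel / Neumann–Yukawa closed
forms (card P1–P3) ride with it as prover lemmas. [difficulty: L] [Onsager1939, LiebNarnhofer1975,
BlancLewin2015]
#9 StabilityMilestone (support) — THE ONE-CENTRE MILESTONE (card K2 as an explicit stability
constant): E_LJ(x) ≥ −0.78·N for every finite configuration of distinct points in ℝ³ (standing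
rigorous constant ≈ −1.19 from B_LJ ≤ 14.316; truth ≈ −0.7176). Intended proof: E ≥ Σ_i λ_i⁰ ≥
N·λ_min with λ_min = inf over stars of (1/24)Σ_facet |s|⁻¹² − T(Vor_star, 0; 0)/12 ≈ −0.76 by
interval branch-and-bound with certified enclosures of T (monotonicity in the cell;
sub/supersolutions for the Neumann–Yukawa problems). Stand-alone deliverable; not an antecedent of
the deciding theorem. [difficulty: L] [Yuhjtman2015, BlancLewin2015, HalesMcLaughlin2010]

TWO-LAYER PLAN. Foreseen once FluxCellKepler is attacked (nothing filed now): FluxCellKepler ⇐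
OneCentreTable → FacetTransfer → FluxCellKepler, with
OneCentreTable = certified λ-values of all δ-separated stars (the StabilityMilestone computation,
refined per star class) and FacetTransfer =
a first-shell transfer rule between adjacent cells that lifts every star class to ≥ e(P₀) with slack
c off the layered family (the Flyspeck-type
step); and, if the q = 0 functional is killed by a non-Barlow cell, FluxCellKepler ⇐ TypedFluxRule →
FluxCellKepler(q) with the antisymmetric
facet-flux version of FluxTubeBound as glue.

KILL CRITERIA. Refutation of FluxCellKepler as typed for EVERY local τ (e.g. a δ-separated periodic
competitor X with E(X)/N < e(P) for all periodic P of the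
layered family plus a proof that no local credit can charge it — in practice: an
amorphous/Frank–Kasper energy-density minimiser) closes the
route `refuted:FluxCellKepler`; a bcc/A15/σ cell over-credited by > 2 % at q = 0 forces the pivot to
the typed flux rule (Two-layer plan), not a
close. Refutation of PeriodicGivenLayered (Sturmian LJ stacking) breaks this route together with
HullMinimality: pivot to a P-window defect count
inside KEPLER (stacking resolved by the cell functional itself, σ_h ≪ ΔS₆) — a restate, costed in
the card. Mooted by: Crystallization proved
elsewhere; PeriodicWindows (3240) proved elsewhere makes crux 3 and the supports idle but leaves
FluxCellKepler as the (i)-certificate line.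

NOT DECOMPOSED YET. The facet-flux RULE q (kept existential inside τ), the Voronoi-cell bookkeeping
(τ may truncate cells to radius R₁/2: T is monotone in the
cell, so DOM survives), the star classification and interval enclosures behind StabilityMilestone,
the compactness-in-a step of
FloorGivesLayered, and the antisymmetric-flux / heat-kernel forms of FluxTubeBound — all layer-2 or
prover lemmas (`--supports`).
KeplerEnergyFloor and FloorGivesLayered are routine (M) and filed as supports; if the gate
back-fills them as cruxes, their ranks are 4 and 5.

CHEAPEST FALSIFIER. Compute the q = 0 cell value mean λ⁰ = S₁₂/24 − T(Vor; 0)/12 (scale-optimised: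
−T²/(24·S₁₂)) for bcc (truncated octahedron; its hexagonal
facets are NOT lattice mirrors), A15, σ and C15 with the card author's Neumann–Yukawa MFS solver: a
value below e(hcp*) = −0.71759 by more than
1e-6 kills FluxCellKepler at q = 0 and forces the typed flux rule. Margin available for bcc: e(bcc*)
= −0.686 vs e* = −0.7176, i.e. the
over-credit of S₆(bcc) must stay below ≈ 2.2 %. NOT run in this session (hub compute-free, solver
lives in the mechhunt seat's folder);
the card's own falsifiers (T(RD) = S₆(fcc) to 7.6e-7, T(cube) = S₆(sc) to 1.5e-5,
T(dodecahedron)/S₆(fcc) = 1.0238) all passed.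

NUMBERS. e* ≈ e(hcp*) = −0.717589, e(fcc*) = −0.717517 (S₆²/(24·S₁₂); S₆(hcp) = 14.4548972, S₆(fcc)
= 14.4539200, S₁₂(hcp) = 12.132294,
S₁₂(fcc) = 12.131880; Stillinger2001, SchwerdtfegerBurrowsSmits2021); ΔS₆ = 9.77e-4; σ_h = T(hcp
cell) − S₆(hcp) = +2.7e-6 ± 1e-5;
T(regular dodecahedron, inradius ½) = 14.7974 = 1.0238·S₆(fcc); one-centre values λ_fcc-star =
−0.7254, λ_hcp-star = −0.7255,
λ_ico-star = −0.7603 (5.9 % below e*); t₈ = T(unit 3-ball) = 0.3953; standing rigorous stability e*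
≥ −1.193 (B_LJ ≤ 14.316, Yuhjtman2015)
vs the milestone −0.78; Green constant 2π⁴ (Φ₈ = |y|⁻⁶/(2π⁴)); layered-family box a ∈ [47/50, 1],
spacing increments ∈ [39a/50, 17a/20]
(hcp* a ≈ 0.971, c/a ≈ 1.633 inside); LJ minimal distance δ proved qualitatively
(LennardJonesMinimalDistance_holds).

DEFINITION REQUESTS. None needed to type the items (the flux-tube functional is written inline in
FluxTubeBound over EuclideanSpace ℝ (Fin 8), MemLp, gradient,
weak divergence; the layered family inline over triangularVec₁/₂, barlowOffset, layerNormal,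
haggLabel, IsHaggSeq). Foreseen named
definitions once provers start (filed then, topic
Summits/AtomisticToContinuum/Crystallization/Theorems): `fluxTubeEnergy a Ω x` (the sInf in
FluxTubeBound), `voronoiCell x i`, `facetFlux` (antisymmetric wall data), `layeredGood R η x i` (the
defect predicate shared by three items).

Novelty: Searches (2026-08-16, this seat; searchd/FTS down, OpenAlex/S2 429 during the session): `lit
frontier AtomisticToContinuum --since 2021` (30 rows; crystallization descendants arXiv:2604.19239
Kreutz–Ziereis rigid polycrystals (READ pp 1–2, 35–36: frame-indifferent cell energies, presupposes
the local theorem), arXiv:2407.20762 planar arbitrary norm — none on tails/potential theory); `lit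
search "local complexity Delone sets crystallinity Lagarias Pleasants"` (crossref 8, the 2002 CMB
paper; unrelated engine, recorded); `lit search "Lennard-Jones ground state hcp polytypes zero
pressure stacking"` (crossref 8, Gardner–Radin 1979 only); `lit galaxy search "crystallization
conjecture three dimensions Lennard-Jones" --star all` (0/0/0); the 33 open route files' mechanism
lines and the 28 open + 80 closed cards of the sub read for technique classes (none uses Thomson,
Neumann tubes, higher-dimensional electrostatics or heat content); the card's own search log (galaxy
bm25/intelligent ×3, zbMATH/arXiv/crossref ×5, 0 relevant) and the mechcritic's reduction attempts
(Onsager/Lieb–Narnhofer; Caffarelli–Silvestre/Petrache–Serfaty extension for s < d) inherited.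
Nearest prior art found: doi:10.1021/j150389a001 (Onsager 1939 smearing lemma) and
doi:10.1007/bf01040705 (Lieb–Narnhofer 1975 ion-sphere bound) — Coulomb in the physical dimension,
inequality only, no confinement, no equality case; among routes, ThreeConeCertificate
(Bochner-priced positive-type tail) and FreeSplittingCertific  [refs: 10.1021/j150389a001, 10.1007/bf01040705, 2604.19239, 2407.20762, doi:10.1021/j150389a001, doi:10.1007/bf01040705]

Barriers (technique_class: harmonic-lift-flux-tube, confined-heat-cell): - technique_class: harmonic-lift-flux-tube, confined-heat-cell
- Literature.Barriers.AtomisticToContinuum.TetrahedralFrustration: APPLIES verbatim to the raw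
single-cell (q = 0, no transfer) relaxation and its bite is MEASURED (one-centre value 5.9 % below
e*): that is StabilityMilestone's regime, conceded; FluxCellKepler evades it as the catalogue
prescribes — reapportion between cells — except that reapportioning = facet flux is derived, every
antisymmetric flux is admissible with nothing to certify, and mis-transfer costs only quadratically.
- Literature.Barriers.AtomisticToContinuum.ShortRangeStackingBlindness: a one-shell cell functional
"should" be stacking-blind; this one is not (σ_h > 0 by Holmgren, ≈ 2.7e-6 ≪ ΔS₆) because T depends
on cell SHAPE, not on distances — the barrier's own evasion (star-localised data); the stacking is
nevertheless NOT decided inside crux 2 (layered family uncharged) but in crux 3, so a reversal of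
the hcp/fcc order does not touch the route.
- Literature.Barriers.AtomisticToContinuum.LocalizedPotentialsExcludeLennardJones: irrelevant — V is
never localised or truncated; the FIELD is confined; the harmonic lift needs the exact inverse-power
tail, i.e. the true (12,6) potential of the Statement.
- Literature.Barriers.AtomisticToContinuum.Li2022_cohnElkies3D: not a two-point bound — the
functional is configuration-wise and nonlinear in the cell shape; the 3-D LP gap is silent about it.
- Literature.Barriers.AtomisticToContinuum.IcosahedralClus

History (route lifecycle, newest last):
- 2026-08-26T13:40:19Z · DORMANT — reconciler: no traction for 6.7 d (last activity item-evidence-added at 2026-08-19T20:44:19Z); parked, not closed — `ledger route dormant route-AtomisticToConti (operator:999:3235856)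

sub-problem: Crystallization · status: dormant · opened planner-plan-novel-AtomisticToContinuum-Crystal-ad211d65-0 2026-08-16T14:05:26Z · rev 4 · ledger route-AtomisticToContinuum-FluxTubeKepler
GENERATED by the gate from the ledger (D-0016/17). Provers cite these decls: `theorem foo : Summit.AtomisticToContinuum.Crystallization.Theses.FluxTubeKepler.<Decl> := …` in Summits/AtomisticToContinuum/Crystallization/Theorems/<Name>.lean.
-/

namespace Summit.AtomisticToContinuum.Crystallization.Theses.FluxTubeKepler

open scoped BigOperators Topology Manifold Classical MeasureTheory ProbabilityTheory Matrix InnerProductSpace ComplexConjugate ContinuousMap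
open Filter Set Function TopologicalSpace MeasureTheory

attribute [summit_statement] _root_.Crystallization

/-- item stmt-AtomisticToContinuum-15221 · crux · rank 2 · open · by planner
why it might fail: Hales-sized: raw one-centre value 5.9 % below e* (dodecahedral cell +2.4 % in T) ⇒ first-shell transfer unavoidable; sharp constant needs τ exact to <7e-5 on fcc/polytype sites and O(strain²) below the phonon penalty on relaxed layers; a bcc/A15 cell over-credited by >2 % kills q = 0.
sources: HalesDSP2012, Hales2012, FlatleyTheil2015, BlancLewin2015, Onsager1939, LiebNarnhofer1975
[crux] FLUX-CELL KEPLER INEQUALITY (card K1, domination folded in). There are P₀ :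
PeriodicConfiguration 3, R₁ and τ : Finset ℝ³ → ℝ with (DOM) Σ_i siteEnergy(r⁻⁶) ≤ Σ_i τ({x_j − x_i
: |x_j − x_i| ≤ R₁}) for every finite injective configuration, and (KEPLER) for every δ > 0 and
every R, η > 0 some c > 0 such that for every δ-separated finite configuration c·#{i : no a ∈
[47/50,1], linear isometry A, Hägg word s, layer heights z with increments in [39a/50, 17a/20] make
the R-neighbourhood of x_i two-way η-matched with the layered set
A{i·u(a)+j·v(a)+L_s(m)·w(a)+z(m)e₃}} ≤ Σ_i ((1/24)·siteEnergy(r⁻¹²)_i − (1/12)·τ(pattern_i)) −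
N·e(P₀). Intended τ = 2π⁴(T(Vor_i, x_i; q) − T(ℝ³)) with a local antisymmetric facet-flux rule q
exact on the Barlow bond types (card), for which DOM is Thomson's principle in ℝ⁸ (FluxTubeBound)
and every q is admissible. [difficulty: open-problem] -/
@[route_item "route-AtomisticToContinuum-FluxTubeKepler", crux]
def FluxCellKepler : Prop :=
  ∃ (P₀ : Literature.MathematicalPhysics.StatisticalMechanics.PeriodicConfiguration 3) (R₁ : ℝ) (τ : Finset (EuclideanSpace ℝ (Fin 3)) → ℝ), (∀ (N : ℕ) (x : Fin N → EuclideanSpace ℝ (Fin 3)), Function.Injective x → ∑ i, Literature.MathematicalPhysics.StatisticalMechanics.siteEnergy (fun r => (r⁻¹) ^ 6) x i ≤ ∑ i, τ ((Finset.univ.filter fun j : Fin N => dist (x j) (x i) ≤ R₁).image fun j => x j - x i)) ∧ (∀ δ : ℝ, 0 < δ → ∀ R η : ℝ, 0 < R → 0 < η → ∃ c : ℝ, 0 < c ∧ ∀ (N : ℕ) (x : Fin N → EuclideanSpace ℝ (Fin 3)), Function.Injective x → (∀ i j, i ≠ j → δ ≤ dist (x i) (x j)) → c * (Nat.card {i :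 Fin N // ¬ ∃ a : ℝ, 47 / 50 ≤ a ∧ a ≤ 1 ∧ ∃ (A : EuclideanSpace ℝ (Fin 3) →ₗᵢ[ℝ] EuclideanSpace ℝ (Fin 3)) (s : ℤ → ℤ) (z : ℤ → ℝ), Literature.MathematicalPhysics.StatisticalMechanics.IsHaggSeq s ∧ (∀ m : ℤ, 39 / 50 * a ≤ z (m + 1) - z m ∧ z (m + 1) - z m ≤ 17 / 20 * a) ∧ let S : Set (EuclideanSpace ℝ (Fin 3)) := {p | ∃ m k l : ℤ, p = A (((k : ℝ) • Literature.MathematicalPhysics.StatisticalMechanics.triangularVec₁ a) + ((l : ℝ) • Literature.MathematicalPhysics.StatisticalMechanics.triangularVec₂ a) + ((Literature.MathematicalPhysics.StatisticalMechanics.haggLabel s m : ℝ) • Literature.MathematicalPhysics.StatisticalMechanics.barlowOffset a) + (z m • Literature.MathematicalPhysics.StatisticalMechanics.layerNormal 1))}; (∀ p ∈ S, ‖p‖ ≤ R → ∃ j : Fin N, dist (x j - x i) p ≤ η) ∧ (∀ j : Fin N, ‖x j - x i‖ ≤ R → ∃ p ∈ S, dist (x j - x i) p ≤ η)} : ℝ)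 ≤ ∑ i, ((1 / 24 : ℝ) * Literature.MathematicalPhysics.StatisticalMechanics.siteEnergy (fun r => (r⁻¹) ^ 12) x i - (1 / 12 : ℝ) * τ ((Finset.univ.filter fun j : Fin N => dist (x j) (x i) ≤ R₁).image fun j => x j - x i)) - (N : ℝ) * P₀.energyPerParticle Literature.MathematicalPhysics.StatisticalMechanics.lennardJones)

/-- item stmt-AtomisticToContinuum-11779 · crux · rank 3 · closed · proved by Summit.AtomisticToContinuum.Crystallization.Theorems.LayeredHull.PeriodicGivenLayered_of @ 3a4fd92cd160 (prover) · by planner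
why it might fail: Fails if Hägg domination |J₂| > Σ(k−1)|J_k| breaks on the relaxed (a, spacing) box (ratio 287–587, uncertified numerics; an exceptional coupling gives Sturmian words = Hubbard risk), or if faults are syndetic in every layered limit.
sources: LoachAckland2017, PartayOrtnerCsanyi2017, Stillinger2001, Radin1991, Literature.Barriers.AtomisticToContinuum.ShortRangeStackingBlindness, Literature.Barriers.AtomisticToContinuum.Hubbard1978_mostHomogeneous
[crux] PERIODIC GIVEN LAYERED (card items H2/H3 "zero fault density suffices"; stacking selection
INSIDE THE HULL): for every sequence of LJ ground states, layered windows at every scale in the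
sense of LayeredWindows (same a, A, t, s, z data) imply periodic windows at every scale in the sense
of PeriodicWindows (one periodic P; expected relaxed hcp = a rotated barlowPeriodicConfiguration of
the alternating word, but ANY periodic polytype is allowed). Intended mechanism: Hägg domination on
the box (LjRegistryDomination stmt-3063 feeding the Peierls count HaggDominationAllRanges stmt-0737)
prices every non-alternating letter pair at ≥ c > 0 per unit area; dislocation-loop surgery at
radius ρ ≫ C/c shows the fault density of an energy-minimising layered limit is zero; fault-free
slabs of every thickness relax exponentially to constant spacing; compactness of O(3) × [47/50,1]
fixes one P. Only a SYNDETIC fault pattern in every layered limit defeats it. [deps: LayeredWindows]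
[difficulty: L] -/
@[route_item "route-AtomisticToContinuum-FluxTubeKepler", crux]
def PeriodicGivenLayered : Prop :=
  ∀ x : (N : ℕ) → (Fin N → EuclideanSpace ℝ (Fin 3)), (∀ N, Literature.MathematicalPhysics.StatisticalMechanics.IsGroundState Literature.MathematicalPhysics.StatisticalMechanics.lennardJones (x N)) → (∃ a : ℝ, 47 / 50 ≤ a ∧ a ≤ 1 ∧ ∀ R ε : ℝ, 0 < ε → ∃ᶠ N in Filter.atTop, ∃ (A : EuclideanSpace ℝ (Fin 3) →ₗᵢ[ℝ] EuclideanSpace ℝ (Fin 3)) (t : EuclideanSpace ℝ (Fin 3)) (s : ℤ → ℤ) (z : ℤ → ℝ), Literature.MathematicalPhysics.StatisticalMechanics.IsHaggSeq s ∧ (∀ m : ℤ, 39 / 50 * a ≤ z (m + 1) - z m ∧ z (m + 1) - z m ≤ 17 / 20 * a) ∧ let S : Set (EuclideanSpace ℝ (Fin 3)) := {p | ∃ m i j : ℤ, p = A (((i : ℝ) • Literature.MathematicalPhysics.StatisticalMechanics.triangularVec₁ a) + ((j : ℝ) • Literature.MathematicalPhysics.StatisticalMechanics.triangularVec₂ a)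 + ((Literature.MathematicalPhysics.StatisticalMechanics.haggLabel s m : ℝ) • Literature.MathematicalPhysics.StatisticalMechanics.barlowOffset a) + (z m • Literature.MathematicalPhysics.StatisticalMechanics.layerNormal 1))}; (∀ p ∈ S, ‖p‖ ≤ R → ∃ i : Fin N, dist (x N i + t) p ≤ ε) ∧ (∀ i : Fin N, ‖x N i + t‖ ≤ R → ∃ p ∈ S, dist (x N i + t) p ≤ ε)) → ∃ P : Literature.MathematicalPhysics.StatisticalMechanics.PeriodicConfiguration 3, ∀ R ε : ℝ, 0 < ε → ∃ᶠ N in Filter.atTop, ∃ t : EuclideanSpace ℝ (Fin 3), (∀ s ∈ P.points, ‖s‖ ≤ R → ∃ i : Fin N, dist (x N i + t) s ≤ ε) ∧ (∀ i : Fin N, ‖x N i + t‖ ≤ R → ∃ s ∈ P.points, dist (x N i + t) s ≤ ε)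

/-- `PeriodicGivenLayered` holds: proved by `Summit.AtomisticToContinuum.Crystallization.Theorems.LayeredHull.PeriodicGivenLayered_of` @ 3a4fd92cd160. -/
theorem PeriodicGivenLayered_holds : PeriodicGivenLayered := _root_.Summit.AtomisticToContinuum.Crystallization.Theorems.LayeredHull.PeriodicGivenLayered_of

/-- item stmt-AtomisticToContinuum-15222 · crux · rank 9 · closed · proved by Summit.AtomisticToContinuum.Crystallization.Theorems.keplerEnergyFloor_proof @ d70a6e8d5cb0 (prover) · by planner
why it might fail: Bookkeeping: 2E = Σ site energies, DOM, KEPLER with D ≥ 0 and the proved minimal distance; fails only on a mis-scaled constant (1/24, 1/12 vs siteEnergy without the 1/2), hand-checked; crux only because closes takes it as hypothesis (crux-only gate).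
sources: BlancLewin2015, Yuhjtman2015
[support] From FluxCellKepler and the proved minimal distance of LJ ground states: there is P₀ with
N·e(P₀) ≤ E(x) for every LJ ground state x (energy identity 2E = Σ site energies, DOM, KEPLER with D
≥ 0), and for all R, η > 0 some c > 0 with c·#(non-layered sites of x) ≤ E(x) − N·e(P₀) along ground
states. Routine bookkeeping (M). [difficulty: M] -/
@[route_item "route-AtomisticToContinuum-FluxTubeKepler", crux]
def KeplerEnergyFloor : Prop :=
  FluxCellKepler → Literature.MathematicalPhysics.StatisticalMechanics.LennardJonesMinimalDistance → ∃ P₀ : Literature.MathematicalPhysics.StatisticalMechanics.PeriodicConfiguration 3, (∀ (N : ℕ) (x : Fin N → EuclideanSpace ℝ (Fin 3)), Literature.MathematicalPhysics.StatisticalMechanics.IsGroundState Literature.MathematicalPhysics.StatisticalMechanics.lennardJones x → (N : ℝ) * P₀.energyPerParticle Literature.MathematicalPhysics.StatisticalMechanics.lennardJones ≤ Literature.MathematicalPhysics.StatisticalMechanics.interactionEnergy Literature.MathematicalPhysics.StatisticalMechanics.lennardJones x) ∧ (∀ R η : ℝ, 0 < R → 0 < η → ∃ c : ℝ, 0 <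 c ∧ ∀ (N : ℕ) (x : Fin N → EuclideanSpace ℝ (Fin 3)), Literature.MathematicalPhysics.StatisticalMechanics.IsGroundState Literature.MathematicalPhysics.StatisticalMechanics.lennardJones x → c * (Nat.card {i : Fin N // ¬ ∃ a : ℝ, 47 / 50 ≤ a ∧ a ≤ 1 ∧ ∃ (A : EuclideanSpace ℝ (Fin 3) →ₗᵢ[ℝ] EuclideanSpace ℝ (Fin 3)) (s : ℤ → ℤ) (z : ℤ → ℝ), Literature.MathematicalPhysics.StatisticalMechanics.IsHaggSeq s ∧ (∀ m : ℤ, 39 / 50 * a ≤ z (m + 1) - z m ∧ z (m + 1) - z m ≤ 17 / 20 * a) ∧ let S : Set (EuclideanSpace ℝ (Fin 3)) := {p | ∃ m k l : ℤ, p = A (((k : ℝ) • Literature.MathematicalPhysics.StatisticalMechanics.triangularVec₁ a) + ((l : ℝ) • Literature.MathematicalPhysics.StatisticalMechanics.triangularVec₂ a) + ((Literature.MathematicalPhysics.StatisticalMechanics.haggLabel s m : ℝ) • Literature.MathematicalPhysics.StatisticalMechanics.barlowOffset a) + (z m • Literature.MathematicalPhysics.StatisticalMechanics.layerNormal 1))};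 (∀ p ∈ S, ‖p‖ ≤ R → ∃ j : Fin N, dist (x j - x i) p ≤ η) ∧ (∀ j : Fin N, ‖x j - x i‖ ≤ R → ∃ p ∈ S, dist (x j - x i) p ≤ η)} : ℝ) ≤ Literature.MathematicalPhysics.StatisticalMechanics.interactionEnergy Literature.MathematicalPhysics.StatisticalMechanics.lennardJones x - (N : ℝ) * P₀.energyPerParticle Literature.MathematicalPhysics.StatisticalMechanics.lennardJones)

-- `KeplerEnergyFloor` holds: proved by `Summit.AtomisticToContinuum.Crystallization.Theorems.keplerEnergyFloor_proof` @ d70a6e8d5cb0 (its module imports this route file, so no `_holds` link can be stated here).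

/-- item stmt-AtomisticToContinuum-15223 · crux · rank 9 · closed · proved by Summit.AtomisticToContinuum.Crystallization.Theorems.FluxTubeKeplerFloorGivesLayered.FloorGivesLayered_proof @ 3c83e5bc4cf2 (prover) · by planner
why it might fail: The one spacing a must be extracted OUTSIDE the (R, ε) quantifiers from per-window a_N ∈ [47/50,1]: compactness + Lipschitz dependence of the layered set on a inside B(0,R) (error C·R·|a_N − a|, so R → R−1, ε → 2ε); a boundary slip in the two-way matching costs the same.
sources: BlancLewin2015, PartayOrtnerCsanyi2017
[support] From the floor and the defect budget to the hypothesis of PeriodicGivenLayered, per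
ground-state sequence: E(N) − N·e(P₀) = o(N) (crysEnergyLimit + eStar_le, in tree) ⇒ the number of
non-layered sites is o(N) ⇒ for N large some site is (R, η)-layered-good with a spacing a_N ∈
[47/50,1]; compactness of [47/50,1] and Lipschitz dependence of the layered set on a inside B(0,R)
fix ONE a for all scales (ε doubled, R decreased by 1). Bookkeeping (M). [difficulty: M] -/
@[route_item "route-AtomisticToContinuum-FluxTubeKepler", crux]
def FloorGivesLayered : Prop :=
  ∀ P₀ : Literature.MathematicalPhysics.StatisticalMechanics.PeriodicConfiguration 3, (∀ (N : ℕ) (x : Fin N → EuclideanSpace ℝ (Fin 3)), Literature.MathematicalPhysics.StatisticalMechanics.IsGroundState Literature.MathematicalPhysics.StatisticalMechanics.lennardJones x → (N : ℝ) * P₀.energyPerParticle Literature.MathematicalPhysics.StatisticalMechanics.lennardJones ≤ Literature.MathematicalPhysics.StatisticalMechanics.interactionEnergy Literature.MathematicalPhysics.StatisticalMechanics.lennardJones x) → (∀ R η : ℝ, 0 < R → 0 < η → ∃ c : ℝ, 0 < c ∧ ∀ (N : ℕ) (x : Fin N → EuclideanSpace ℝ (Fin 3)), Literature.MathematicalPhysics.StatisticalMechanics.IsGroundState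 Literature.MathematicalPhysics.StatisticalMechanics.lennardJones x → c * (Nat.card {i : Fin N // ¬ ∃ a : ℝ, 47 / 50 ≤ a ∧ a ≤ 1 ∧ ∃ (A : EuclideanSpace ℝ (Fin 3) →ₗᵢ[ℝ] EuclideanSpace ℝ (Fin 3)) (s : ℤ → ℤ) (z : ℤ → ℝ), Literature.MathematicalPhysics.StatisticalMechanics.IsHaggSeq s ∧ (∀ m : ℤ, 39 / 50 * a ≤ z (m + 1) - z m ∧ z (m + 1) - z m ≤ 17 / 20 * a) ∧ let S : Set (EuclideanSpace ℝ (Fin 3)) := {p | ∃ m k l : ℤ, p = A (((k : ℝ) • Literature.MathematicalPhysics.StatisticalMechanics.triangularVec₁ a) + ((l : ℝ) • Literature.MathematicalPhysics.StatisticalMechanics.triangularVec₂ a) + ((Literature.MathematicalPhysics.StatisticalMechanics.haggLabel s m : ℝ) • Literature.MathematicalPhysics.StatisticalMechanics.barlowOffset a) + (z m • Literature.MathematicalPhysics.StatisticalMechanics.layerNormal 1))}; (∀ p ∈ S, ‖p‖ ≤ R → ∃ j : Fin N, dist (x j - x i) p ≤ η) ∧ (∀ j : Fin N, ‖x j - x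 i‖ ≤ R → ∃ p ∈ S, dist (x j - x i) p ≤ η)} : ℝ) ≤ Literature.MathematicalPhysics.StatisticalMechanics.interactionEnergy Literature.MathematicalPhysics.StatisticalMechanics.lennardJones x - (N : ℝ) * P₀.energyPerParticle Literature.MathematicalPhysics.StatisticalMechanics.lennardJones) → ∀ x : (N : ℕ) → (Fin N → EuclideanSpace ℝ (Fin 3)), (∀ N, Literature.MathematicalPhysics.StatisticalMechanics.IsGroundState Literature.MathematicalPhysics.StatisticalMechanics.lennardJones (x N)) → (∃ a : ℝ, 47 / 50 ≤ a ∧ a ≤ 1 ∧ ∀ R ε : ℝ, 0 < ε → ∃ᶠ N in Filter.atTop, ∃ (A : EuclideanSpace ℝ (Fin 3) →ₗᵢ[ℝ] EuclideanSpace ℝ (Fin 3)) (t : EuclideanSpace ℝ (Fin 3)) (s : ℤ → ℤ) (z : ℤ → ℝ), Literature.MathematicalPhysics.StatisticalMechanics.IsHaggSeq s ∧ (∀ m : ℤ, 39 / 50 * a ≤ z (m + 1) - z m ∧ z (m + 1) - z m ≤ 17 / 20 * a) ∧ let S : Set (EuclideanSpace ℝ (Fin 3)) := {p | ∃ m i j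 : ℤ, p = A (((i : ℝ) • Literature.MathematicalPhysics.StatisticalMechanics.triangularVec₁ a) + ((j : ℝ) • Literature.MathematicalPhysics.StatisticalMechanics.triangularVec₂ a) + ((Literature.MathematicalPhysics.StatisticalMechanics.haggLabel s m : ℝ) • Literature.MathematicalPhysics.StatisticalMechanics.barlowOffset a) + (z m • Literature.MathematicalPhysics.StatisticalMechanics.layerNormal 1))}; (∀ p ∈ S, ‖p‖ ≤ R → ∃ i : Fin N, dist (x N i + t) p ≤ ε) ∧ (∀ i : Fin N, ‖x N i + t‖ ≤ R → ∃ p ∈ S, dist (x N i + t) p ≤ ε))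

-- `FloorGivesLayered` holds: proved by `Summit.AtomisticToContinuum.Crystallization.Theorems.FluxTubeKeplerFloorGivesLayered.FloorGivesLayered_proof` @ 3c83e5bc4cf2 (its module imports this route file, so no `_holds` link can be stated here).

/-- item stmt-AtomisticToContinuum-15224 · support · rank 9 · open · by planner
sources: BlancLewin2015
[support] HULL CRITERION (the proved shared item stmt-3243 with PeriodicWindows inlined, so that the
decl is self-contained in this file; closed by `exact` of the tree proof): PeriodicWindows ⇒
IsCrystallizing lennardJones 3 (extraction along (R, ε) = (j+1, 1/(j+1)), minimal distance, local
convergence with multiplicity 1). [difficulty: provable-now] -/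
@[route_item "route-AtomisticToContinuum-FluxTubeKepler"]
def HullCriterion : Prop :=
  (∀ x : (N : ℕ) → (Fin N → EuclideanSpace ℝ (Fin 3)), (∀ N, Literature.MathematicalPhysics.StatisticalMechanics.IsGroundState Literature.MathematicalPhysics.StatisticalMechanics.lennardJones (x N)) → ∃ P : Literature.MathematicalPhysics.StatisticalMechanics.PeriodicConfiguration 3, ∀ R ε : ℝ, 0 < ε → ∃ᶠ N in Filter.atTop, ∃ t : EuclideanSpace ℝ (Fin 3), (∀ s ∈ P.points, ‖s‖ ≤ R → ∃ i : Fin N, dist (x N i + t) s ≤ ε) ∧ (∀ i : Fin N, ‖x N i + t‖ ≤ R → ∃ s ∈ P.points, dist (x N i + t) s ≤ ε)) → Literature.MathematicalPhysics.StatisticalMechanics.IsCrystallizing Literature.MathematicalPhysics.StatisticalMechanics.lennardJones 3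

/-- item stmt-AtomisticToContinuum-15225 · support · rank 9 · open · by planner
sources: Onsager1939, LiebNarnhofer1975, BlancLewin2015
[support] THE FLUX-TUBE BOUND (card P1 at zero wall flux; Thomson's principle in ℝ⁸, TYPED): for
every smearing radius a > 0, every finite configuration x in ℝ³ and every family of pairwise
disjoint cells Ω_i ⊇ closedBall(x_i, a): Σ_i Σ_(j≠i) |x_i − x_j|⁻⁶ ≤ 2π⁴ Σ_i (T_a(Ω_i, x_i) −
T_a(ℝ³, x_i)), where T_a(Ω, x₀) is the infimum of ∫|F|² over L² vector fields F on ℝ⁸ = ℝ³ × ℝ⁵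
vanishing off the tube Ω × ℝ⁵ whose weak divergence (against all C¹ compactly supported φ) is the
uniform probability on the 8-ball of radius a about (x₀, 0). Proof: Newton's theorem (disjoint balls
interact as points, |y|⁻⁶ harmonic in ℝ⁸), completing the square against the true field (density of
C¹_c in Ḣ¹(ℝ⁸)), disjoint tube supports; admissible confined fields exist because the transverse
dimension 5 ≥ 3. Equality iff the true field has zero flux through every wall (mirror-complete
cells: fcc, sc). The general antisymmetric-flux version and the heat-kernel / Neumann–Yukawa closed
forms (card P1–P3) ride with it as prover lemmas. [difficulty: L] -/
@[route_item "route-AtomisticToContinuum-FluxTubeKepler"]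
def FluxTubeBound : Prop :=
  ∀ a : ℝ, 0 < a → ∀ (N : ℕ) (x : Fin N → EuclideanSpace ℝ (Fin 3)) (Ω : Fin N → Set (EuclideanSpace ℝ (Fin 3))), (Pairwise fun i j => Disjoint (Ω i) (Ω j)) → (∀ i, Metric.closedBall (x i) a ⊆ Ω i) → let ι : EuclideanSpace ℝ (Fin 3) → EuclideanSpace ℝ (Fin 8) := fun v => (EuclideanSpace.equiv (Fin 8) ℝ).symm (fun k => if h : (k : ℕ) < 3 then v ⟨k, h⟩ else 0); let π : EuclideanSpace ℝ (Fin 8) → EuclideanSpace ℝ (Fin 3) := fun y => (EuclideanSpace.equiv (Fin 3) ℝ).symm (fun k => y (Fin.castLE (by norm_num) k)); let T : Set (EuclideanSpace ℝ (Fin 3)) → EuclideanSpace ℝ (Fin 3) → ℝ := fun Ω₀ x₀ => sInf {e : ℝ | ∃ F : EuclideanSpace ℝ (Fin 8) → EuclideanSpace ℝ (Fin 8), MemLp F 2 volume ∧ (∀ y, π y ∉ Ω₀ → F y = 0) ∧ (∀ φ : EuclideanSpace ℝ (Fin 8) → ℝ, ContDiff ℝ 1 φ → HasCompactSupport φ →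 ∫ y, inner ℝ (F y) (gradient φ y) = -(((volume (Metric.ball (ι x₀) a)).toReal)⁻¹ * ∫ y in Metric.ball (ι x₀) a, φ y)) ∧ e = ∫ y, ‖F y‖ ^ 2}; ∑ i, Literature.MathematicalPhysics.StatisticalMechanics.siteEnergy (fun r => (r⁻¹) ^ 6) x i ≤ 2 * Real.pi ^ 4 * ∑ i, (T (Ω i) (x i) - T Set.univ (x i))

/-- item stmt-AtomisticToContinuum-15226 · support · rank 9 · open · by planner
sources: Yuhjtman2015, BlancLewin2015, HalesMcLaughlin2010
[support] THE ONE-CENTRE MILESTONE (card K2 as an explicit stability constant): E_LJ(x) ≥ −0.78·N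
for every finite configuration of distinct points in ℝ³ (standing rigorous constant ≈ −1.19 from
B_LJ ≤ 14.316; truth ≈ −0.7176). Intended proof: E ≥ Σ_i λ_i⁰ ≥ N·λ_min with λ_min = inf over stars
of (1/24)Σ_facet |s|⁻¹² − T(Vor_star, 0; 0)/12 ≈ −0.76 by interval branch-and-bound with certified
enclosures of T (monotonicity in the cell; sub/supersolutions for the Neumann–Yukawa problems).
Stand-alone deliverable; not an antecedent of the deciding theorem. [difficulty: L] -/
@[route_item "route-AtomisticToContinuum-FluxTubeKepler"]
def StabilityMilestone : Prop :=
  ∀ (N : ℕ) (x : Fin N → EuclideanSpace ℝ (Fin 3)), Function.Injective x → -((39 : ℝ) / 50) * N ≤ Literature.MathematicalPhysics.StatisticalMechanics.interactionEnergy Literature.MathematicalPhysics.StatisticalMechanics.lennardJones x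

/-- item stmt-AtomisticToContinuum-3240 · support · rank 9 · open · by planner
sources: BlancLewin2015, Radin1991
[target] PERIODIC WINDOWS (finite form of "some local limit of translated LJ ground states has a
non-empty periodic configuration in its orbit closure"): for every sequence of Lennard-Jones ground
states x^N in ℝ³ there is one periodic configuration P such that for every R and every ε > 0,
frequently in N, some translate x^N + t is two-way ε-matched with P.points on the closed ball B(0,R)
(every site of P in the ball has a particle within ε and every particle in the ball has a site
within ε). Equivalent to IsCrystallizing lennardJones 3 (HullCriterion + HullCriterionConverse). -/
@[route_item "route-AtomisticToContinuum-FluxTubeKepler"]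
def PeriodicWindows : Prop :=
  ∀ x : (N : ℕ) → (Fin N → EuclideanSpace ℝ (Fin 3)), (∀ N, Literature.MathematicalPhysics.StatisticalMechanics.IsGroundState Literature.MathematicalPhysics.StatisticalMechanics.lennardJones (x N)) → ∃ P : Literature.MathematicalPhysics.StatisticalMechanics.PeriodicConfiguration 3, ∀ R ε : ℝ, 0 < ε → ∃ᶠ N in Filter.atTop, ∃ t : EuclideanSpace ℝ (Fin 3), (∀ s ∈ P.points, ‖s‖ ≤ R → ∃ i : Fin N, dist (x N i + t) s ≤ ε) ∧ (∀ i : Fin N, ‖x N i + t‖ ≤ R → ∃ s ∈ P.points, dist (x N i + t) s ≤ ε)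

/-- item stmt-AtomisticToContinuum-15227 · assembly · rank 1 · open · by planner
sources: BlancLewin2015
[assembly] FluxCellKepler → PeriodicGivenLayered → KeplerEnergyFloor → FloorGivesLayered →
HullCriterion → Crystallization (the implication proved by `closes`). -/
@[route_item "route-AtomisticToContinuum-FluxTubeKepler"]
def Assembly : Prop :=
  FluxCellKepler → PeriodicGivenLayered → KeplerEnergyFloor → FloorGivesLayered → HullCriterion → _root_.Crystallization

/-! D-0027 §2.1 — DECIDING THEOREM (planner-authored via `route open/edit --closes-file`; by planner-plan-novel-AtomisticToContinuum-Crystal-ad211d65-0 2026-08-16T14:09:30Z):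
its hypotheses are this route's items and its conclusion the sub-problem Statement (glue_lint), and it elaborates with this file. -/

@[closes "route-AtomisticToContinuum-FluxTubeKepler"] theorem closes (hK : FluxCellKepler) (hPGL : PeriodicGivenLayered) (hFloor : KeplerEnergyFloor)
    (hLay : FloorGivesLayered) : _root_.Crystallization := by
  obtain ⟨P₀, hE, hD⟩ := hFloor hK
    Literature.MathematicalPhysics.StatisticalMechanics.LennardJonesMinimalDistance_holds
  have hPW : PeriodicWindows := fun x hx => hPGL x hx (hLay P₀ hE hD x hx)
  -- conjunct (ii): the hull criterion (shared item stmt-3243) is PROVED in the tree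
  have hii : Literature.MathematicalPhysics.StatisticalMechanics.IsCrystallizing
      Literature.MathematicalPhysics.StatisticalMechanics.lennardJones 3 :=
    Summit.AtomisticToContinuum.Crystallization.Theorems.PrestressSplitKorn.stub_hullCriterion
      (fun x hx => hPW x hx)
  -- conjunct (i)
  have hlim := Summit.AtomisticToContinuum.Crystallization.Theorems.ChargedEnergyGapNegative.crysEnergyLimit
  set e := (⨅ Q : Literature.MathematicalPhysics.StatisticalMechanics.PeriodicConfiguration 3,
    Q.energyPerParticle Literature.MathematicalPhysics.StatisticalMechanics.lennardJones) with he
  have hle : P₀.energyPerParticle Literature.MathematicalPhysics.StatisticalMechanics.lennardJones ≤ e := by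
    refine ge_of_tendsto hlim (Filter.eventually_atTop.2 ⟨1, fun N hN => ?_⟩)
    obtain ⟨x, hx⟩ := Literature.MathematicalPhysics.StatisticalMechanics.LennardJonesGroundStatesExist_holds N
    have h1 := hE N x hx
    have hNr : (0 : ℝ) < N := by exact_mod_cast hN
    rw [le_div_iff₀ hNr, mul_comm]
    rw [hx.2] at h1
    exact h1
  have hge : ∀ Q : Literature.MathematicalPhysics.StatisticalMechanics.PeriodicConfiguration 3,
      e ≤ Q.energyPerParticle Literature.MathematicalPhysics.StatisticalMechanics.lennardJones :=
    Summit.AtomisticToContinuum.Crystallization.Theorems.ChargedEnergyGapNegative.eStar_le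
  have hleast : IsLeast (Set.range fun Q : Literature.MathematicalPhysics.StatisticalMechanics.PeriodicConfiguration 3 =>
      Q.energyPerParticle Literature.MathematicalPhysics.StatisticalMechanics.lennardJones)
      (P₀.energyPerParticle Literature.MathematicalPhysics.StatisticalMechanics.lennardJones) := by
    refine ⟨⟨P₀, rfl⟩, ?_⟩
    rintro _ ⟨Q, rfl⟩
    exact hle.trans (hge Q)
  have heq : e = P₀.energyPerParticle Literature.MathematicalPhysics.StatisticalMechanics.lennardJones :=
    le_antisymm (hge P₀) hle
  have hi : Literature.MathematicalPhysics.StatisticalMechanics.HasPeriodicGroundStateEnergy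
      Literature.MathematicalPhysics.StatisticalMechanics.lennardJones 3 := by
    refine ⟨P₀, hleast, ?_⟩
    rw [← heq]
    exact hlim
  exact ⟨hi, hii⟩

end Summit.AtomisticToContinuum.Crystallization.Theses.FluxTubeKepler
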